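import Mathlib.NumberTheory.Padics.PadicNumbers
import Mathlib.Analysis.AbsoluteValue.Equivalence
import Mathlib.Analysis.SpecialFunctions.Log.Basic
import Mathlib.FieldTheory.IsAlgClosed.Basic
import Mathlib.Algebra.Group.Subgroup.Basic
import HarnessLib

/-!
# Joshi, *Arithmetic Teichmüller spaces III* §10.1–§10.4: the ELEMENTARY Frobenioid of a valued field, induced
# Frobenioid structures (Prop. 10.3.3), perfect / realified Frobenioids (Prop. 10.4.1.1) — TYPED, no side taken

Record file of the abc-iut cell, branch E «type Joshi's construction, test vs S» (rung LADDER-ABC:A2.E; seat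
abc-iut-E-t32, slot T-34 = [J-III] §10 «Appendix: Frobenioids and Hodge-Theaters à la Mochizuki via [Joshi 2021a]»;
inventory `HOME/plan/E/t32/INVENTORY.tsv`; sequel `Joshi/HodgeTheatersJoshi.lean` = §10.5–§10.11). Source: K. Joshi,
*Construction of Arithmetic Teichmüller Spaces III*, arXiv:2401.13508 **v4** ("Preliminary version for comments"),
render `HOME/lit/renders/Joshi-arxiv-2401.13508/pNNNN.txt`, locator «p.N l.M» = line M of PDF page N (printed page
= N − 1); bib `Joshi2024ATS3`. UNREFEREED preprint, rejected by the IUT author [Mochizuki2024JoshiReport], accepted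
by neither side of the Scholze–Stix / Mochizuki dispute: everything below is TYPED AS A CANDIDATE (D-0012); typed ≠
proved ≠ endorsed; statements Joshi asserts are named `def … : Prop` with `@[claim "Joshi2024ATS3" "disputed"]`,
never asserted; what FOLLOWS from the typed signature is a proved `theorem`. Nothing here mentions abc or the Cor.
3.12 vocabulary (E-PLAN R14: object files do not import the frozen interface).

Joshi (p.128 l.71–73): «I will not use the broad definition of Frobenioids given in [Mochizuki, 2008] but use
[Mochizuki, 2008, Example 6.1 and Example 6.3]» — every Frobenioid of §10 is an ELEMENTARY triple
`(Φ, K^* → Φ^gp, deg)`, typed here over a Mathlib `AbsoluteValue K ℝ`: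
* §1 = §10.1–10.2 (p.129 l.1 – p.131 l.13): `O^▹_K`, `O^*_K` = `Frob.intMonoid`, `Frob.unitGroup ≤ Kˣ`;
  `Φ(K) = O^▹_K/O^*_K` (10.2.2) and `Φ(K)^gp` are rendered THROUGH Joshi's «canonical isomorphism of monoids
  `Φ(K) ≃ |O^▹_K|_K`» (10.2.3) and `Φ(K) → Φ(K)^gp → |K^*|` (10.2.5) as value monoid ≤ value group inside `ℝ^×`
  (`Frob.divMonoid ≤ Frob.divGroup`; READING, flagged for E-ref); `Frob(K,|−|_K) = (Φ(K), K^* → Φ(K)^gp)`,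
  «`x ↦ x mod O^*_K`» (10.2.6)–(10.2.7) = `Frob.prin` (kernel `O^*`); the degrees `x ↦ log(|x|_K)` (10.2.8)–(10.2.11),
  `z ↦ log(|z|_ℂ)` (10.1.3) = `Frob.deg`, factoring through `Φ^gp` (10.2.10); `ℚ_p`: (10.2.12), (10.2.14) PROVED.
* §2 = §10.3 (p.131 l.14 – p.132 l.23): induced structures `Frob(E,|−|_K)` (10.3.2) = `Frob.induced`; **Prop. 10.3.3**
  (1) abstract isomorphism = `Frob.Prop1033_1`, (2) no degree-compatible isomorphism = `Frob.Prop1033_2` (claim-Props);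
  DERIVED: (1) from Joshi's proof sentence «isomorphic as [discretely] valued fields» read as Mathlib's
  `AbsoluteValue.IsEquiv`, (2) from `|x|₁ ≠ |x|₂`, both from the DILATATION shape `|−|₂ = |−|₁^c`, `c ≠ 1` of ATS I
  (`Frob.prop1033_of_rpow`; = the shape of seat E-t1's `UntiltPoints.IsDilatation`). The existence of untilts `K`
  with `v_K(p) ≠ v_{ℂ_p}(p)` (p.132 l.22–23) is ATS I / [FF18] content of seat E-t1, NOT re-typed. §10.3 is the print
  home in [J-III] of the valuation-RESCALING move: «Frobenioid unchanged, arithmetic degree changes».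
* §3 = §10.4 (p.132 l.24 – p.133 l.12): «one wants to allow valuations to be scaled by rationals (say
  `|−|_{ℚ_p} ↦ |−|^{1/j²}_{ℚ_p}`) … Mochizuki remedies this with … perfect and realified Frobenioids»; **Prop. 10.4.1.1**
  (1)–(3) = `Frob.Prop1041_1/2/3` over `Frob.IsPerfectDiv` ([FrdI] §0 «perfect», read on the divisor group) and
  `Frob.HasRealValueGroup`; DERIVED: (1) for algebraically closed `K`, (2), (3) as the inclusion into a perfect
  divisor group («natural perfection» = READING, flagged). Rmk. 10.4.1.2 = locator only.
Deliberately NOT here: [FrdI] Def. 1.1–1.3 categories (tree: `Literature.AlgebraicGeometry.Frobenioids.*`), the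
Fargues–Fontaine curve, untilts (seat E-t1's `Untilt`; any `NormedField` enters via `Frob.normAbs`), any test
against S. [claim: Joshi2024ATS3, status: disputed]
-/

noncomputable section

open Function

namespace Summit.ABC.IUTFork.Joshi.ATS3

universe u

/-! ## 1. §10.1–10.2: the elementary Frobenioid of a valued field `(K, |−|_K)` -/

namespace Frob

variable {K : Type u} [Field K] (v : AbsoluteValue K ℝ)

/-- `O^▹_K = O_K − {0}` «considered as a multiplicative monoid» (§10.2, p.129 l.26–28), as the submonoid
`{x : |x|_K ≤ 1}` of `Kˣ`. [claim: Joshi2024ATS3, status: disputed] -/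
def intMonoid : Submonoid Kˣ where
  carrier := {x | v (x : K) ≤ 1}
  one_mem' := by simp
  mul_mem' {x y} (hx : v _ ≤ 1) (hy : v _ ≤ 1) := show v _ ≤ 1 by rw [Units.val_mul, map_mul]; exact mul_le_one₀ hx (v.nonneg _) hy

/-- `O^*_K`, «the group of units of `O_K`» (§10.2, p.129 l.28–29): `{x : |x|_K = 1} ≤ Kˣ`.
[claim: Joshi2024ATS3, status: disputed] -/
def unitGroup : Subgroup Kˣ where
  carrier := {x | v (x : K) = 1}
  one_mem' := by simp
  mul_mem' {x y} (hx : v _ = 1) (hy : v _ = 1) := by simp only [Set.mem_setOf_eq, Units.val_mul, map_mul, hx, hy, mul_one]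
  inv_mem' {x} (hx : v _ = 1) := by simp only [Set.mem_setOf_eq, Units.val_inv_eq_inv_val, map_inv₀, hx, inv_one]

/-- Membership in `O^▹_K`. [folklore] -/
@[simp] theorem mem_intMonoid (x : Kˣ) : x ∈ intMonoid v ↔ v (x : K) ≤ 1 := Iff.rfl

/-- Membership in `O^*_K`. [folklore] -/
@[simp] theorem mem_unitGroup (x : Kˣ) : x ∈ unitGroup v ↔ v (x : K) = 1 := Iff.rfl

/-- `O^*_K ⊆ O^▹_K` (p.129 l.34–36: «its submonoid of units»). [folklore] -/
theorem unitGroup_le_intMonoid : (unitGroup v).toSubmonoid ≤ intMonoid v := fun _ hx => le_of_eq hx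

/-- `|−|_K` on `K^*` as a homomorphism `Kˣ →* ℝˣ` (the map `Φ(K) → |O^▹_K|_K → |K^*|_K` of (10.2.3)–(10.2.4)
on the level of `K^*`). [claim: Joshi2024ATS3, status: disputed] -/
def absUnits : Kˣ →* ℝˣ := Units.map v.toMonoidHom

/-- `absUnits` is `|−|_K`. [folklore] -/
@[simp] theorem val_absUnits (x : Kˣ) : (absUnits v x : ℝ) = v (x : K) := rfl

/-- `Φ(K)^gp`, «the group associated to the monoid `Φ(K)`», through (10.2.5) `Φ(K) → Φ(K)^gp → |K^*|`: for a
field the value group `|K^*|_K ≤ ℝ^×` (§10.2, p.130 l.5–10). [claim: Joshi2024ATS3, status: disputed] -/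
def divGroup : Subgroup ℝˣ := (absUnits v).range

/-- `Φ(K) = O^▹_K/O^*_K` (10.2.2), rendered through «the canonical isomorphism of monoids `Φ(K) ≃ |O^▹_K|_K`»
(10.2.3, p.130 l.1–4) as the value monoid `|O^▹_K|_K ≤ ℝ^×`. [claim: Joshi2024ATS3, status: disputed] -/
def divMonoid : Submonoid ℝˣ := (intMonoid v).map (absUnits v)

/-- `Φ(K) ⊆ Φ(K)^gp` (10.2.5). [folklore] -/
theorem divMonoid_le_divGroup : divMonoid v ≤ (divGroup v).toSubmonoid := by
  rintro r ⟨x, -, rfl⟩; exact ⟨x, rfl⟩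

/-- `|x|_K ∈ |O^▹_K|` iff `|x|_K ≤ 1`. [folklore] -/
theorem absUnits_mem_divMonoid_iff (x : Kˣ) : absUnits v x ∈ divMonoid v ↔ v (x : K) ≤ 1 := by
  constructor
  · rintro ⟨y, hy, hyx⟩
    have : v (y : K) = v (x : K) := by simpa using congrArg (fun r : ℝˣ => (r : ℝ)) hyx
    exact this ▸ hy
  · exact fun hx => ⟨x, hx, rfl⟩

/-- `Frob(K,|−|_K) = (Φ(K), K^* → Φ(K)^gp)`: «the natural homomorphism `K^* → Φ(K)^gp` given by mapping
`x ↦ x mod O^*_K`» (10.2.6)–(10.2.7), p.130 l.11–17; archimedean case (10.1.2)/(10.1.4), p.129 l.10–18. Through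
(10.2.3) it is `x ↦ |x|_K`. [claim: Joshi2024ATS3, status: disputed] -/
def prin : Kˣ →* divGroup v := (absUnits v).rangeRestrict

/-- Through (10.2.3), `x mod O^*_K` is `|x|_K`. [folklore] -/
@[simp] theorem val_prin (x : Kˣ) : ((prin v x : ℝˣ) : ℝ) = v (x : K) := rfl

/-- `K^* → Φ(K)^gp` is onto (for a field, `Φ(K)^gp = K^*/O^*_K`). [folklore] -/
theorem prin_surjective : Surjective (prin v) := (absUnits v).rangeRestrict_surjective

/-- The kernel of `x ↦ x mod O^*_K` is `O^*_K` (10.2.7). [folklore] -/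
theorem prin_eq_one_iff (x : Kˣ) : prin v x = 1 ↔ x ∈ unitGroup v := by
  refine ⟨fun h => ?_, fun h => by ext; simpa using h⟩
  simpa using congrArg (fun r : divGroup v => ((r : ℝˣ) : ℝ)) h

/-- `ker (K^* → Φ(K)^gp) = O^*_K`. [folklore] -/
theorem ker_prin : (prin v).ker = unitGroup v :=
  Subgroup.ext fun x => by rw [MonoidHom.mem_ker, prin_eq_one_iff]

/-- The image of `O^▹_K` under `x ↦ x mod O^*_K` is `Φ(K)` (10.2.2)–(10.2.3). [folklore] -/
theorem prin_mem_divMonoid_iff (x : Kˣ) : (prin v x : ℝˣ) ∈ divMonoid v ↔ x ∈ intMonoid v :=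
  absUnits_mem_divMonoid_iff v x

/-- `log : ℝ^× → ℝ` as a homomorphism (to `Multiplicative ℝ`): the common shape of the degree maps (10.1.3),
(10.2.9). [folklore] -/
def logHom : ℝˣ →* Multiplicative ℝ where
  toFun r := Multiplicative.ofAdd (Real.log (r : ℝ))
  map_one' := by simp
  map_mul' r s := by rw [← ofAdd_add, Units.val_mul, Real.log_mul r.ne_zero s.ne_zero]

/-- `logHom` is `log`. [folklore] -/
@[simp] theorem toAdd_logHom (r : ℝˣ) : (logHom r).toAdd = Real.log (r : ℝ) := rfl

/-- The (local) ARITHMETIC DEGREE on `Φ(K)^gp`: «`Φ(K) → ℝ` given by `x ↦ log(|x|_K)` … factors as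
`Φ(K) → Φ(K)^gp → ℝ`» (10.2.8)–(10.2.10), p.130 l.18–25. [claim: Joshi2024ATS3, status: disputed] -/
def degGp : divGroup v →* Multiplicative ℝ := logHom.comp (divGroup v).subtype

/-- `deg_K : K^* → ℝ`, `x ↦ log(|x|_K)` (10.2.11), p.130 l.26–28; for `(K,|−|_K) ≃ (ℂ,|−|_ℂ)` the «archimedean
(arithmetic) degree homomorphism» `z ↦ log(|z|_ℂ)` (10.1.3), p.129 l.12–15. [claim: Joshi2024ATS3, status: disputed] -/
def deg : Kˣ →* Multiplicative ℝ := logHom.comp (absUnits v)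

/-- `deg_K(x) = log(|x|_K)` (10.2.11). [claim: Joshi2024ATS3, status: disputed] -/
theorem toAdd_deg (x : Kˣ) : (deg v x).toAdd = Real.log (v (x : K)) := rfl

/-- (10.2.10)–(10.2.11): `deg_K` is the composite `K^* → Φ(K)^gp → ℝ`. [claim: Joshi2024ATS3, status: disputed] -/
theorem deg_eq_degGp_prin (x : Kˣ) : deg v x = degGp v (prin v x) := rfl

/-- On `O^▹_K` the degree `log|x|_K` is `≤ 0` (Joshi's sign convention (10.2.9); [FrdI] Ex. 6.3 uses `−log`).
[folklore] -/
theorem toAdd_deg_nonpos {x : Kˣ} (hx : x ∈ intMonoid v) : (deg v x).toAdd ≤ 0 :=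
  Real.log_nonpos (v.nonneg _) hx

/-- On `O^*_K` the degree vanishes. [folklore] -/
theorem toAdd_deg_eq_zero {x : Kˣ} (hx : x ∈ unitGroup v) : (deg v x).toAdd = 0 := by
  rw [toAdd_deg, (mem_unitGroup v x).1 hx, Real.log_one]

/-- The absolute value of a normed field as a Mathlib `AbsoluteValue` (so that `ℚ_p`, `ℂ_p` and seat E-t1's
untilts `Untilt.K` feed the constructions above). [folklore] -/
def normAbs (K : Type u) [NormedField K] : AbsoluteValue K ℝ :=
  IsAbsoluteValue.toAbsoluteValue (norm : K → ℝ)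

/-- `normAbs` is the norm. [folklore] -/
@[simp] theorem normAbs_apply {K : Type u} [NormedField K] (x : K) : normAbs K x = ‖x‖ := rfl

/-- (10.2.13)–(10.2.14), p.131 l.5–13 (with the normalisation (10.2.1) `|p|_{ℂ_p} = p⁻¹`):
`deg_{ℚ_p}(p) = log(|p|_{ℚ_p}) = −log p`. [claim: Joshi2024ATS3, status: disputed] -/
theorem toAdd_deg_padic_p (p : ℕ) [Fact p.Prime] :
    (deg (normAbs ℚ_[p]) (Units.mk0 (p : ℚ_[p]) (by exact_mod_cast (Fact.out : p.Prime).ne_zero))).toAdd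
      = -Real.log p := by
  rw [toAdd_deg, Units.val_mk0, normAbs_apply, Padic.norm_p, Real.log_inv]

/-- (10.2.12), p.131 l.1–4: `Φ(ℚ_p)^gp = ℤ` — every value `|x|_{ℚ_p}`, `x ≠ 0`, is an integral power of `p`.
[claim: Joshi2024ATS3, status: disputed] -/
theorem exists_zpow_of_mem_divGroup_padic (p : ℕ) [Fact p.Prime] {r : ℝˣ}
    (hr : r ∈ divGroup (normAbs ℚ_[p])) : ∃ n : ℤ, (r : ℝ) = (p : ℝ) ^ n := by
  obtain ⟨x, rfl⟩ := hr
  refine ⟨-(x : ℚ_[p]).valuation, ?_⟩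
  rw [val_absUnits, normAbs_apply, Padic.norm_eq_zpow_neg_valuation x.ne_zero]

end Frob

/-! ## 2. §10.3: induced Frobenioid structures; Proposition 10.3.3 -/

namespace Frob

variable {E : Type u} {K : Type u} [Field E] [Field K]

/-- «The Frobenioid structure on `E` induced by `K`» (10.3.2), p.131 l.21–27: for a homomorphism of fields
`ι : E → K` and `|−|_K`, the elementary Frobenioid of `E` for the pulled-back absolute value `x ↦ |ι(x)|_K` — i.e.
all of §1 applied to `Frob.induced w ι`. [claim: Joshi2024ATS3, status: disputed] -/
def induced (w : AbsoluteValue K ℝ) (ι : E →+* K) : AbsoluteValue E ℝ := w.comp ι.injective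

/-- The induced absolute value is `x ↦ |ι(x)|_K` (10.3.2). [claim: Joshi2024ATS3, status: disputed] -/
@[simp] theorem induced_apply (w : AbsoluteValue K ℝ) (ι : E →+* K) (x : E) : induced w ι x = w (ι x) := rfl

/-- `Frob(E,|−|_K) ⊂ Frob(K,|−|_K)` is a SUB-Frobenioid (p.131 l.22–24): `Φ(E,|−|_K)^gp ≤ Φ(K)^gp` — also the
inclusion of Prop. 10.4.1.1 (3) «`Frob(E) ↪ Frob(K)` provides a natural perfection». [claim: Joshi2024ATS3, status: disputed] -/
theorem divGroup_induced_le (w : AbsoluteValue K ℝ) (ι : E →+* K) : divGroup (induced w ι) ≤ divGroup w := by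
  rintro r ⟨x, rfl⟩
  refine ⟨Units.map (ι : E →* K) x, Units.ext ?_⟩
  simp [absUnits]

variable (v₁ v₂ : AbsoluteValue E ℝ)

/-- An (abstract) ISOMORPHISM of the elementary Frobenioids `(Φ(E), E^* → Φ(E)^gp)` of two absolute values on the
same field `E` (Prop. 10.3.3, p.132 l.2–3 «abstractly isomorphic»): an isomorphism of divisor groups carrying the
divisor monoid onto the divisor monoid and compatible with `x ↦ x mod O^*`. [claim: Joshi2024ATS3, status: disputed] -/
structure FrobIso where
  /-- `Φ(E,v₁)^gp ≃ Φ(E,v₂)^gp` -/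
  gpIso : divGroup v₁ ≃* divGroup v₂
  /-- compatible with `E^* → Φ^gp` -/
  map_prin : ∀ x : Eˣ, gpIso (prin v₁ x) = prin v₂ x
  /-- carries `Φ(E,v₁)` onto `Φ(E,v₂)` -/
  map_div : ∀ r : divGroup v₁, ((gpIso r : ℝˣ) ∈ divMonoid v₂ ↔ (r : ℝˣ) ∈ divMonoid v₁)

/-- **Prop. 10.3.3 (1)** (p.132 l.2–3), for the two structures `v₁ = |−|_{ℂ_p}|_E`, `v₂ = |ι(−)|_K`: «The two
Frobenioid structures on `E` induced by `E ↪ ℂ_p` and `ι : E ↪ K` are abstractly isomorphic.» Named, not asserted.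
[claim: Joshi2024ATS3, status: disputed] -/
@[claim "Joshi2024ATS3" "disputed"]
def Prop1033_1 : Prop := Nonempty (FrobIso v₁ v₂)

/-- An isomorphism «compatible with identity homomorphism on `ℝ` in the arithmetic degree homomorphisms
`x ↦ log(|x|_{ℂ_p})` (resp. `x ↦ log(|x|_K)`)» (p.132 l.4–7), i.e. the diagram (10.3.4) commutes.
[claim: Joshi2024ATS3, status: disputed] -/
def FrobIso.DegCompatible {v₁ v₂ : AbsoluteValue E ℝ} (e : FrobIso v₁ v₂) : Prop :=
  ∀ r : divGroup v₁, degGp v₂ (e.gpIso r) = degGp v₁ r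

/-- **Prop. 10.3.3 (2)** (p.132 l.4–7, l.11–23): «there may not exist any isomorphism of the two Frobenioid
structures … compatible with identity homomorphism on `ℝ` in the arithmetic degree homomorphisms … if the valuation of
`p` in `ℂ_p` and valuation of `p` in `K` do not coincide». Typed as the non-existence for the given pair.
[claim: Joshi2024ATS3, status: disputed] -/
@[claim "Joshi2024ATS3" "disputed"]
def Prop1033_2 : Prop := ¬ ∃ e : FrobIso v₁ v₂, e.DegCompatible

variable {v₁ v₂}

/-- Equivalent absolute values have the same `O^*` (kernel condition for lifting `prin`). [folklore] -/
theorem ker_prin_le_of_isEquiv (h : v₁.IsEquiv v₂) : (prin v₁).ker ≤ (prin v₂).ker := by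
  intro x hx
  rw [MonoidHom.mem_ker, prin_eq_one_iff, mem_unitGroup] at hx ⊢
  exact h.eq_one_iff.1 hx

/-- The homomorphism `Φ(E,v₁)^gp → Φ(E,v₂)^gp`, `|x|₁ ↦ |x|₂`, for equivalent `v₁`, `v₂`. [folklore] -/
def liftPrin (h : v₁.IsEquiv v₂) : divGroup v₁ →* divGroup v₂ :=
  (prin v₁).liftOfSurjective (prin_surjective v₁) ⟨prin v₂, ker_prin_le_of_isEquiv h⟩

/-- `liftPrin` maps `|x|₁ ↦ |x|₂`. [folklore] -/
@[simp] theorem liftPrin_prin (h : v₁.IsEquiv v₂) (x : Eˣ) : liftPrin h (prin v₁ x) = prin v₂ x :=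
  (prin v₁).liftOfRightInverse_comp_apply _ _ _ x

/-- The two lifts are mutually inverse. [folklore] -/
theorem liftPrin_liftPrin (h : v₁.IsEquiv v₂) (r : divGroup v₁) : liftPrin h.symm (liftPrin h r) = r := by
  obtain ⟨x, rfl⟩ := prin_surjective v₁ r
  simp

/-- **Prop. 10.3.3 (1), DERIVED** from Joshi's proof sentence «`E` and `ι(E)` are isomorphic as valued fields, as both
are discretely valued» (p.132 l.8–10) read as: the two absolute values on `E` are EQUIVALENT (Mathlib
`AbsoluteValue.IsEquiv`; for two untilts this is the dilatation relation `v₂ = v₁ ^ c`, see `prop1033_of_rpow`).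
Then `|x|₁ ↦ |x|₂` is an isomorphism of Frobenioids. [folklore] -/
theorem prop1033_1_of_isEquiv (h : v₁.IsEquiv v₂) : Prop1033_1 v₁ v₂ := by
  refine ⟨{ gpIso := ?_, map_prin := ?_, map_div := ?_ }⟩
  · exact { toFun := liftPrin h, invFun := liftPrin h.symm, left_inv := liftPrin_liftPrin h,
            right_inv := liftPrin_liftPrin h.symm, map_mul' := map_mul _ }
  · intro x
    exact liftPrin_prin h x
  · intro r
    obtain ⟨x, rfl⟩ := prin_surjective v₁ r
    change ((liftPrin h (prin v₁ x) : ℝˣ) ∈ divMonoid v₂ ↔ _)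
    rw [liftPrin_prin, prin_mem_divMonoid_iff, prin_mem_divMonoid_iff, mem_intMonoid, mem_intMonoid]
    exact (h.le_one_iff).symm

/-- **Prop. 10.3.3 (2), DERIVED core**: if `|x|₁ ≠ |x|₂` for a single `x ∈ E^*` (print: `x = p`,
`log(|p|_{ℂ_p}) ≠ log(|ι(p)|_K)`, p.132 l.22–23), then NO isomorphism of the two Frobenioid structures is compatible
with the degrees and the identity of `ℝ` — evaluate (10.3.4) at `x`. [folklore] -/
theorem prop1033_2_of_ne {x : Eˣ} (hx : v₁ (x : E) ≠ v₂ (x : E)) : Prop1033_2 v₁ v₂ := by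
  rintro ⟨e, he⟩
  have h1 := congrArg Multiplicative.toAdd (he (prin v₁ x))
  rw [e.map_prin, ← deg_eq_degGp_prin, ← deg_eq_degGp_prin, toAdd_deg, toAdd_deg] at h1
  exact hx (Real.log_injOn_pos (v₁.pos x.ne_zero) (v₂.pos x.ne_zero) h1.symm)

/-- **Prop. 10.3.3 for a DILATATION** `|−|₂ = |−|₁ ^ c` (`0 < c`, `c ≠ 1`; the shape of seat E-t1's
`UntiltPoints.IsDilatation`, ATS I «norms … differing by a dilatation by factor `r`»): given some `x ∈ E^*` with
`0 < |x|₁ ≠ 1` (print: `x = p`), the two Frobenioid structures ARE abstractly isomorphic and are NOT degree-compatibly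
isomorphic — (1) and (2) together. [folklore] -/
theorem prop1033_of_rpow {c : ℝ} (hc : 0 < c) (hc1 : c ≠ 1) (h : ∀ y : E, v₂ y = v₁ y ^ c)
    {x : Eˣ} (hx1 : v₁ (x : E) ≠ 1) : Prop1033_1 v₁ v₂ ∧ Prop1033_2 v₁ v₂ := by
  have heq : v₁.IsEquiv v₂ := AbsoluteValue.isEquiv_iff_exists_rpow_eq.2 ⟨c, hc, funext fun y => (h y).symm⟩
  refine ⟨prop1033_1_of_isEquiv heq, prop1033_2_of_ne (x := x) ?_⟩
  have h0 : 0 < v₁ (x : E) := v₁.pos x.ne_zero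
  rw [h]
  intro hxe
  have hlog := congrArg Real.log hxe
  rw [Real.log_rpow h0] at hlog
  have hl0 : Real.log (v₁ (x : E)) ≠ 0 := Real.log_ne_zero_of_pos_of_ne_one h0 hx1
  exact hc1 ((mul_eq_right₀ hl0).1 hlog.symm)

end Frob

/-! ## 3. §10.4: perfect and realified Frobenioids from perfectoid fields (Prop. 10.4.1.1, Rmk. 10.4.1.2) -/

namespace Frob

variable {K : Type u} [Field K] (v : AbsoluteValue K ℝ)

/-- `Φ(K)^gp` is PERFECT ([FrdI] §0: a monoid is perfect if `x ↦ x^n` is bijective for every `n ≥ 1`; in the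
torsion-free group `|K^*| ≤ ℝ^×` injectivity is automatic, so: every value has an `n`-th root value). The content of
«`Frob(K)` is a perfect Frobenioid in the sense of [Mochizuki, 2008, Definition 1.1]» (Prop. 10.4.1.1 (1)) read on the
divisor group. [claim: Joshi2024ATS3, status: disputed] -/
def IsPerfectDiv : Prop := ∀ n : ℕ, 0 < n → ∀ r ∈ divGroup v, ∃ s ∈ divGroup v, s ^ n = r

/-- «the value group of `K` is equal to `ℝ`» (Prop. 10.4.1.1 (2), p.133 l.2–3): `|K^*| = ℝ_{>0}`.
[claim: Joshi2024ATS3, status: disputed] -/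
def HasRealValueGroup : Prop := ∀ r : ℝˣ, 0 < (r : ℝ) → r ∈ divGroup v

/-- **Prop. 10.4.1.1 (1)** (p.132 l.36 – p.133 l.1): for an arithmetic holomorphic structure `hol_{X/E}(F)_y`,
`y = (K, ι_K : K^♭ ≃ F)` (`K` an algebraically closed perfectoid field): «`Frob(K)` is a perfect Frobenioid».
[claim: Joshi2024ATS3, status: disputed] -/
@[claim "Joshi2024ATS3" "disputed"]
def Prop1041_1 : Prop := IsPerfectDiv v

/-- **Prop. 10.4.1.1 (2)** (p.133 l.2–3): «Suppose additionally that the value group of `K` is equal to `ℝ` … then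
`Frob(K)` is a realified Frobenioid» — read: `Φ(K)^gp = ℝ_{>0}` (and then `Φ(K) = (0,1]`).
[claim: Joshi2024ATS3, status: disputed] -/
@[claim "Joshi2024ATS3" "disputed"]
def Prop1041_2 : Prop := HasRealValueGroup v → IsPerfectDiv v ∧ ∀ r : ℝˣ, 0 < (r : ℝ) → (r : ℝ) ≤ 1 → r ∈ divMonoid v

/-- **Prop. 10.4.1.1 (3)** (p.133 l.4–7): «If `E` is a `p`-adic field and `ι : E ↪ K` is an embedding, the inclusion of
Frobenioids `Frob(E) ↪ Frob(K)` provides a natural perfection `Frob(K)` of `Frob(E)` and if `K` has value group `ℝ`,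
then `Frob(K)` is even a realification of `Frob(E)`» — read on divisor groups: `Φ(E,|−|_K)^gp ≤ Φ(K)^gp` with the
larger one perfect. READING flagged for E-ref («natural perfection» = universal property in [FrdI]; here: inclusion
into a perfect one). Rmk. 10.4.1.2 (p.133 l.9–12): «many topologically inequivalent arithmetic models for the
perfection of `Frob(E)` … central … for the very statement of [IUTchIII, Cor. 3.12]» — locator only.
[claim: Joshi2024ATS3, status: disputed] -/
@[claim "Joshi2024ATS3" "disputed"]
def Prop1041_3 {E : Type u} [Field E] (w : AbsoluteValue K ℝ) (ι : E →+* K) : Prop :=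
  divGroup (induced w ι) ≤ divGroup w ∧ IsPerfectDiv w

variable {v}

/-- **Prop. 10.4.1.1 (1), DERIVED for algebraically closed `K`** (every untilt `K_y` is algebraically closed,
ATS I §3 / seat E-t1's `Untilt`): `|y|^n = |x|` for `y^n = x`. [folklore] -/
theorem isPerfectDiv_of_isAlgClosed [IsAlgClosed K] (v : AbsoluteValue K ℝ) : IsPerfectDiv v := by
  intro n hn r hr
  obtain ⟨x, rfl⟩ := hr
  obtain ⟨y, hy⟩ := IsAlgClosed.exists_pow_nat_eq (x : K) hn
  have hy0 : y ≠ 0 := by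
    rintro rfl
    rw [zero_pow hn.ne'] at hy
    exact x.ne_zero hy.symm
  refine ⟨absUnits v (Units.mk0 y hy0), ⟨Units.mk0 y hy0, rfl⟩, ?_⟩
  rw [← map_pow]
  congr 1
  ext
  simp [hy]

/-- Prop. 10.4.1.1 (2), DERIVED: a value group equal to `ℝ_{>0}` is perfect (`n`-th roots of positive reals) and its
divisor monoid is all of `(0,1]`. [folklore] -/
theorem prop1041_2_holds (v : AbsoluteValue K ℝ) : Prop1041_2 v := by
  intro hR
  refine ⟨fun n hn r hr => ?_, fun r hr0 hr1 => ?_⟩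
  · have hr0 : 0 < (r : ℝ) := by obtain ⟨x, rfl⟩ := hr; rw [val_absUnits]; exact v.pos x.ne_zero
    have hs0 : 0 < (r : ℝ) ^ ((n : ℝ)⁻¹) := Real.rpow_pos_of_pos hr0 _
    refine ⟨Units.mk0 _ hs0.ne', hR _ hs0, Units.ext ?_⟩
    rw [Units.val_pow_eq_pow_val, Units.val_mk0, ← Real.rpow_natCast,
      ← Real.rpow_mul hr0.le, inv_mul_cancel₀ (by exact_mod_cast hn.ne'), Real.rpow_one]
  · obtain ⟨x, hx⟩ := hR r hr0
    refine ⟨x, ?_, hx⟩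
    show v (x : K) ≤ 1
    rw [← val_absUnits, hx]
    exact hr1

/-- Prop. 10.4.1.1 (3), DERIVED for algebraically closed `K`: the inclusion (`divGroup_induced_le`) into a perfect
divisor group. [folklore] -/
theorem prop1041_3_of_isAlgClosed [IsAlgClosed K] {E : Type u} [Field E] (w : AbsoluteValue K ℝ) (ι : E →+* K) :
    Prop1041_3 w ι :=
  ⟨divGroup_induced_le w ι, isPerfectDiv_of_isAlgClosed w⟩

end Frob


end Summit.ABC.IUTFork.Joshi.ATS3
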